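import Literature.AlgebraicGeometry.HodgeTheory.RationalHodgeClasses
import Literature.Geometry.Kaehler.HolomorphicFormsInCharts
import HarnessLib

/-!
# Classes of top-degree holomorphic forms in a Hodge model

For a Hodge model `A : HodgeModel n X` of a smooth complex variety `X` (the complex manifold
`X^an`, charts in `A.model ≅ ℂⁿ`, with its de Rham comparison `A.deRham`), a holomorphic
`n`-form `η ∈ Ω^n(X^an)` (`Literature.Geometry.Kaehler.holFormsInCharts A.model A.carrier n`) is
closed for reasons of type (`IsHolomorphicInCharts.mem_cclosedSmoothForms`, top degree), hence
has a de Rham class; this file records the resulting `ℂ`-linear **class map**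
`A.topHolFormClass : Ω^n(X^an) → Hⁿ(X^an; ℂ)` and proves that its values are of Hodge type
`(n, 0)`, i.e. lie in `A.hodgePQ n n 0` (a holomorphic `n`-form has type `(n,0)`,
`IsHolomorphicInCharts.isOfType`). That the class map is a bijection onto `H^{n,0}` for `X`
projective (Voisin I, Cor. 7.6) is NOT proved here.

References: C. Voisin, *Hodge Theory and Complex Algebraic Geometry I* (2002), §7.1.1, Cor. 7.6;
P. Deligne, *The Hodge conjecture* (2000), §1.
-/

noncomputable section

open scoped Manifold
open Literature.Geometry.Kaehler (holFormsInCharts holFormsInChartsToClosed isOfType_of_mem)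
open Literature.NumberTheory.Transcendental (complexDeRhamCohomology)
open Literature.AlgebraicTopology.SingularHomology (singularCohomology)

namespace Literature.AlgebraicGeometry.HodgeTheory

namespace HodgeModel

variable {n : ℕ} {X : Motives.SchemeOver ℂ} (A : HodgeModel n X)

/-- The model space of a Hodge model of relative dimension `n` has complex dimension `n`.
[cite: SerreGAGA1956, §2] -/
theorem finrank_model : Module.finrank ℂ A.model = n :=
  A.isAnalytification.finrank_eq

/-- **The class map on top-degree holomorphic forms** `Ω^n(X^an) → Hⁿ(X^an; ℂ)`,
`η ↦ [η]`: the inclusion into closed forms (top degree), the de Rham class, and the de Rham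
comparison of the model. [cite: VoisinHodgeI2002, §7.1.1] -/
def topHolFormClass :
    holFormsInCharts A.model A.carrier n →ₗ[ℂ] singularCohomology ℂ ℂ A.carrier n :=
  (A.deRham A.carrier n).toLinearMap ∘ₗ complexDeRhamCohomology.mk A.model A.carrier n ∘ₗ
    holFormsInChartsToClosed A.finrank_model

/-- Unfolding `topHolFormClass`. [folklore] -/
theorem topHolFormClass_apply (η : holFormsInCharts A.model A.carrier n) :
    A.topHolFormClass η = A.deRham A.carrier n
      (complexDeRhamCohomology.mk A.model A.carrier n
        (holFormsInChartsToClosed A.finrank_model η)) :=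
  rfl

/-- **Classes of holomorphic `n`-forms are of Hodge type `(n, 0)`**: `[η] ∈ H^{n,0}(X^an)`.
[cite: VoisinHodgeI2002, Cor. 7.6] -/
theorem topHolFormClass_mem_hodgePQ (η : holFormsInCharts A.model A.carrier n) :
    A.topHolFormClass η ∈ A.hodgePQ n n 0 :=
  Submodule.mem_map_of_mem
    (Submodule.subset_span ⟨holFormsInChartsToClosed A.finrank_model η, isOfType_of_mem η, rfl⟩)

/-- The class map lands in `H^{n,0}`. [cite: VoisinHodgeI2002, Cor. 7.6] -/
theorem range_topHolFormClass_le :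
    LinearMap.range A.topHolFormClass ≤ A.hodgePQ n n 0 := by
  rintro _ ⟨η, rfl⟩
  exact A.topHolFormClass_mem_hodgePQ η

/-- The class map, corestricted to `H^{n,0}(X^an)`. [cite: VoisinHodgeI2002, Cor. 7.6] -/
def topHolFormClassPQ : holFormsInCharts A.model A.carrier n →ₗ[ℂ] A.hodgePQ n n 0 :=
  LinearMap.codRestrict _ A.topHolFormClass A.topHolFormClass_mem_hodgePQ

/-- Unfolding `topHolFormClassPQ`. [folklore] -/
@[simp] theorem coe_topHolFormClassPQ (η : holFormsInCharts A.model A.carrier n) :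
    (A.topHolFormClassPQ η : singularCohomology ℂ ℂ A.carrier n) = A.topHolFormClass η :=
  rfl

end HodgeModel

end Literature.AlgebraicGeometry.HodgeTheory

end
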